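import Summits.QuantumFields.YangMills.Theorems.LuscherReductionDressedRitzPolyakovLiftPScalingSmall
import Summits.QuantumFields.YangMills.Theorems.LuscherReductionDressedRitzPolyakovLiftPScalingParams
import HarnessLib

/-!
# Route `LuscherReduction`, item `DressedRitz` (stmt-QuantumFields-20205), line «polyakovlift» r7, stub S-PSCAL″ — F9 layer D5b, part 1:
# the eight side conditions of the quasimode package as scalar lemmas (fleet seat ym-20205-polyakovlift-s1 gen 3)

Support module (`--supports stmt-QuantumFields-20205`, helper, no closure claim).  The quasimode package (Q) of the S-PSCAL″ assembly
(`PScal.pscaling_core`, LEAD; statement of `quasimode_package` in the LEAD's wave-3 HANDOFF) is conditioned on eight explicit inequalities at `(L, Λ)`: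
with `R = radiusR Λ`, `εb = 24/L² + 4(C_f²I₉)e^{−R}`, `sb = (X·(Λ/L) + A e^{−R})/c_gap`, `s₀ = (X·(Λ/L) + A e^{−2/Λ})/c_gap`, `A' = 2(K+1)(1 + C_top/c_gap)`,
`P = (2A'+1)^{K+2}`, `N = K+1`:

  (S1) `B₁ ≤ 2L³/Λ³`, (S2) `π ≤ 2L³/Λ³`, (S3) `A e^{−R} ≤ 1/4`, (S4) `C_f²I₉e^{−R} ≤ 1/16`, (S5) `N(εb + P(sb + 2A'εb²)) ≤ 1/2`,
  (S6) `P(sb + 2A'εb²) ≤ Λ²/4`, (S7) `s₀ ≤ 1/2`, (S8) `(C_f/c_Q)² e^{2·(4/18)R⁴} s₀ ≤ Λ⁴/256`.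

This file reduces each of (S3)–(S8) to the two normal forms «(constant)·Λ ≤ 1» and «(constant, possibly with `e^{c/lam}/lam^p`) ≤ L» (pure real lemmas in
small contexts): `sc_exp_radius`, `sc_exp_radius_sq` (via `e^{−R} ≤ 12!·Λ³`), `sc_epsb`, `sc_sb`, `sc_five`, `sc_six`, `sc_seven`, `sc_eight`
(`e^{2(4/18)R⁴} = e^{(4/9)/Λ}`, `e^{(4/9)/Λ}e^{−2/Λ} = e^{−(14/9)/Λ}`).  Part 2 (`…PScalingOfQuasimodes.lean`) assembles the thresholds.

HONEST FRAMING: elementary arithmetic for ONE stub of ONE conditional crux on the femto rung R2b1; nothing here bears on infinite volume, the continuum limit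
or the Clay gap.  References: M. Lüscher, NPB 219 (1983) 233 [cite: Luscher1983, §3].
-/

set_option autoImplicit false

noncomputable section

open Real

namespace Summit.QuantumFields.YangMills.Theorems.FemtoTransferGap.PScal

/-! ## §1 Tails `e^{−R}` at the radius `R = Λ^{−1/4}` -/

/-- `P·e^{−R} ≤ c` as soon as `P·12!·Λ ≤ c` (`0 < Λ ≤ 1`): `e^{−R} ≤ 12!Λ³ ≤ 12!Λ`. [cite: Luscher1983, §3] -/
theorem sc_exp_radius {P c Λ : ℝ} (hP : 0 ≤ P) (hΛ : 0 < Λ) (hΛ1 : Λ ≤ 1)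
    (h : P * (Nat.factorial 12 : ℝ) * Λ ≤ c) : P * Real.exp (-radiusR Λ) ≤ c := by
  have h1 := exp_neg_radiusR_le hΛ hΛ1
  have hΛ3 : Λ ^ 3 ≤ Λ := by
    have : Λ ^ 2 ≤ 1 := by rw [pow_two]; exact mul_le_one₀ hΛ1 hΛ.le hΛ1
    calc Λ ^ 3 = Λ ^ 2 * Λ := by ring
      _ ≤ 1 * Λ := mul_le_mul_of_nonneg_right this hΛ.le
      _ = Λ := one_mul Λ
  have hF : (0 : ℝ) ≤ (Nat.factorial 12 : ℝ) := by positivity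
  have h2 : (Nat.factorial 12 : ℝ) * Λ ^ 3 ≤ (Nat.factorial 12 : ℝ) * Λ := mul_le_mul_of_nonneg_left hΛ3 hF
  have h3 := mul_le_mul_of_nonneg_left (h1.trans h2) hP
  linarith [h3]

/-- `P·e^{−R} ≤ c·Λ²` as soon as `P·12!·Λ ≤ c` (`0 < Λ ≤ 1`): `e^{−R} ≤ 12!Λ³ = 12!Λ·Λ²`. [cite: Luscher1983, §3] -/
theorem sc_exp_radius_sq {P c Λ : ℝ} (hP : 0 ≤ P) (hΛ : 0 < Λ) (hΛ1 : Λ ≤ 1)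
    (h : P * (Nat.factorial 12 : ℝ) * Λ ≤ c) : P * Real.exp (-radiusR Λ) ≤ c * Λ ^ 2 := by
  have h1 := exp_neg_radiusR_le hΛ hΛ1
  have h3 := mul_le_mul_of_nonneg_left h1 hP
  have e : P * ((Nat.factorial 12 : ℝ) * Λ ^ 3) = (P * (Nat.factorial 12 : ℝ) * Λ) * Λ ^ 2 := by ring
  rw [e] at h3
  exact h3.trans (mul_le_mul_of_nonneg_right h (sq_nonneg Λ))

/-- `P·e^{−2/Λ} ≤ c` as soon as `P·Λ ≤ 2c` (`P ≥ 0`, `c > 0`, `Λ > 0`): `e^{−2/Λ} ≤ Λ/2`. [cite: Luscher1983, §3] -/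
theorem sc_exp_two {P c Λ : ℝ} (hP : 0 ≤ P) (hc : 0 < c) (hΛ : 0 < Λ) (h : P * Λ ≤ 2 * c) :
    P * Real.exp (-(2 / Λ)) ≤ c := by
  have h1 := smallΛ_exp_neg_div_mul (P := P / c) (b := 2) (div_nonneg hP hc.le) (by norm_num) hΛ 0
    (by
      simp only [Nat.factorial, Nat.succ_eq_add_one, zero_add, Nat.cast_one, mul_one, pow_one]
      rw [div_mul_eq_mul_div, div_le_iff₀ hc]
      linarith)
  rw [pow_zero, div_mul_eq_mul_div, div_le_iff₀ hc, one_mul] at h1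
  exact h1

/-! ## §2 The Gram number `εb` and the quasimode defects `sb`, `s₀` -/

/-- `εb = 24/L² + 4Q e^{−R} ≤ t` from `48 ≤ t·L` (so `24/L² ≤ 24/L ≤ t/2`, `L ≥ 1`) and `4Q e^{−R} ≤ t/2`. [cite: Luscher1983, §3] -/
theorem sc_epsb {Q t Λ : ℝ} {L : ℕ} (hL : 1 ≤ L) (hLt : 48 ≤ t * L)
    (hQ : 4 * Q * Real.exp (-radiusR Λ) ≤ t / 2) :
    24 / (L : ℝ) ^ 2 + 4 * Q * Real.exp (-radiusR Λ) ≤ t := by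
  have hLr : (1 : ℝ) ≤ L := by exact_mod_cast hL
  have hL0 : (0 : ℝ) < L := by linarith
  have h1 : 24 / (L : ℝ) ^ 2 ≤ 24 / (L : ℝ) := by
    refine div_le_div_of_nonneg_left (by norm_num) hL0 ?_
    calc (L : ℝ) = L * 1 := (mul_one _).symm
      _ ≤ L * L := mul_le_mul_of_nonneg_left hLr hL0.le
      _ = (L : ℝ) ^ 2 := (pow_two _).symm
  have h2 : 24 / (L : ℝ) ≤ t / 2 := by
    rw [div_le_iff₀ hL0]; linarith
  linarith

/-- `sb = (X(Λ/L) + A e^{−R})/c ≤ t` from `X(Λ/L) ≤ t c/2` and `A e^{−R} ≤ t c/2`. [cite: Luscher1983, §3] -/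
theorem sc_sb {X A c Λ L t : ℝ} (hc : 0 < c) (hX : X * (Λ / L) ≤ t * c / 2) (hA : A * Real.exp (-radiusR Λ) ≤ t * c / 2) :
    (X * (Λ / L) + A * Real.exp (-radiusR Λ)) / c ≤ t := by
  rw [div_le_iff₀ hc]; linarith

/-- (S7) `s₀ = (X(Λ/L) + A e^{−2/Λ})/c ≤ 1/2` from `X(Λ/L) ≤ c/4` and `A e^{−2/Λ} ≤ c/4`. [cite: Luscher1983, §3] -/
theorem sc_seven {X A c Λ L : ℝ} (hc : 0 < c) (hX : X * (Λ / L) ≤ c / 4) (hA : A * Real.exp (-(2 / Λ)) ≤ c / 4) :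
    (X * (Λ / L) + A * Real.exp (-(2 / Λ))) / c ≤ 1 / 2 := by
  rw [div_le_iff₀ hc]; linarith

/-- `X·(Λ/L) ≤ u` from `X/L ≤ u` and `Λ ≤ 1` (`X ≥ 0`, `L > 0`). [cite: Luscher1983, §3] -/
theorem sc_mul_div_le {X Λ L u : ℝ} (hX : 0 ≤ X) (hL : 0 < L) (hΛ1 : Λ ≤ 1) (h : X / L ≤ u) :
    X * (Λ / L) ≤ u := by
  have h1 : X * (Λ / L) ≤ X * (1 / L) :=
    mul_le_mul_of_nonneg_left (div_le_div_of_nonneg_right hΛ1 hL.le) hX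
  have e : X * (1 / L) = X / L := by ring
  linarith [h1, e ▸ h]

/-- `X·(Λ/L) ≤ u·Λ` from `X/L ≤ u` (`Λ ≥ 0`). [cite: Luscher1983, §3] -/
theorem sc_mul_div_le_mul {X Λ L u : ℝ} (hΛ0 : 0 ≤ Λ) (h : X / L ≤ u) : X * (Λ / L) ≤ u * Λ := by
  have := mul_le_mul_of_nonneg_right h hΛ0
  have e : X / L * Λ = X * (Λ / L) := by ring
  linarith [e ▸ this]

/-! ## §3 (S5) and (S6) from bounds on `εb`, `sb` -/

/-- (S5): if `0 ≤ εb ≤ η`, `sb ≤ η`, `η ≤ 1` and `N(η + P(η + 2A'η)) ≤ 1/2` then `N(εb + P(sb + 2A'εb²)) ≤ 1/2`. [cite: Luscher1983, §3] -/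
theorem sc_five {N P A' η εb sb : ℝ} (hN : 0 ≤ N) (hP : 0 ≤ P) (hA' : 0 ≤ A') (hη1 : η ≤ 1)
    (hηN : N * (η + P * (η + 2 * A' * η)) ≤ 1 / 2) (hεb0 : 0 ≤ εb) (hεb : εb ≤ η) (hsb : sb ≤ η) :
    N * (εb + P * (sb + 2 * A' * εb ^ 2)) ≤ 1 / 2 := by
  have h1 : εb ^ 2 ≤ η := by
    calc εb ^ 2 = εb * εb := pow_two εb
      _ ≤ 1 * εb := mul_le_mul_of_nonneg_right (hεb.trans hη1) hεb0
      _ = εb := one_mul εb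
      _ ≤ η := hεb
  have h2 : 2 * A' * εb ^ 2 ≤ 2 * A' * η := mul_le_mul_of_nonneg_left h1 (by linarith)
  have h3 : P * (sb + 2 * A' * εb ^ 2) ≤ P * (η + 2 * A' * η) := mul_le_mul_of_nonneg_left (by linarith) hP
  have h4 : N * (εb + P * (sb + 2 * A' * εb ^ 2)) ≤ N * (η + P * (η + 2 * A' * η)) :=
    mul_le_mul_of_nonneg_left (by linarith) hN
  exact h4.trans hηN

/-- (S6): if `0 ≤ εb ≤ mΛ` with `16·P·A'·m ≤ 1`, `0 ≤ m ≤ 1`, and `P·sb ≤ Λ²/16`, then `P(sb + 2A'εb²) ≤ Λ²/4`. [cite: Luscher1983, §3] -/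
theorem sc_six {P A' m Λ εb sb : ℝ} (hP : 0 ≤ P) (hA' : 0 ≤ A') (hm0 : 0 ≤ m) (hm1 : m ≤ 1) (hm : 16 * P * A' * m ≤ 1)
    (hεb0 : 0 ≤ εb) (hεb : εb ≤ m * Λ) (hsb : P * sb ≤ Λ ^ 2 / 16) :
    P * (sb + 2 * A' * εb ^ 2) ≤ Λ ^ 2 / 4 := by
  have hmΛ0 : 0 ≤ m * Λ := hεb0.trans hεb
  have h1 : εb ^ 2 ≤ (m * Λ) ^ 2 := pow_le_pow_left₀ hεb0 hεb 2
  have h2 : P * (2 * A' * εb ^ 2) ≤ P * (2 * A' * (m * Λ) ^ 2) :=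
    mul_le_mul_of_nonneg_left (mul_le_mul_of_nonneg_left h1 (by linarith)) hP
  -- `P·2A'·m²Λ² = (2PA'm)·m·Λ² ≤ (1/8)·1·Λ²`
  have h3 : P * (2 * A' * (m * Λ) ^ 2) ≤ Λ ^ 2 / 8 := by
    have e : P * (2 * A' * (m * Λ) ^ 2) = (2 * P * A' * m) * m * Λ ^ 2 := by ring
    rw [e]
    have ha : 2 * P * A' * m ≤ 1 / 8 := by linarith
    have hb : (2 * P * A' * m) * m ≤ 1 / 8 * 1 :=
      mul_le_mul ha hm1 hm0 (by norm_num)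
    have := mul_le_mul_of_nonneg_right hb (sq_nonneg Λ)
    linarith
  have e2 : P * (sb + 2 * A' * εb ^ 2) = P * sb + P * (2 * A' * εb ^ 2) := by ring
  rw [e2]
  linarith [sq_nonneg Λ, h2.trans h3]

/-! ## §4 (S8): the vacuum-defect smallness against the valley ratio -/

/-- `e^{2·(4·(1/18)·R⁴)} = e^{(4/9)/Λ}` (`R⁴ = 1/Λ`). [cite: Luscher1983, §3] -/
theorem exp_quartic_radius {Λ : ℝ} (hΛ : 0 < Λ) :
    Real.exp (2 * (4 * (1 / 18) * radiusR Λ ^ 4)) = Real.exp ((4 / 9) / Λ) := by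
  rw [radiusR_pow_four hΛ]
  congr 1
  ring

/-- (S8): `G·e^{2(4/18)R⁴}·((X(Λ/L) + A e^{−2/Λ})/c) ≤ Λ⁴/256` from the two halves
`G·e^{(4/9)/Λ}·X(Λ/L)/c ≤ Λ⁴/512` and `(G·A/c)·e^{−(14/9)/Λ} ≤ Λ⁴/512`. [cite: Luscher1983, §3] -/
theorem sc_eight {G X A c Λ L : ℝ} (hΛ : 0 < Λ)
    (h1 : G * Real.exp ((4 / 9) / Λ) * (X * (Λ / L)) / c ≤ Λ ^ 4 / 512)
    (h2 : G * A / c * Real.exp (-((14 / 9) / Λ)) ≤ Λ ^ 4 / 512) :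
    G * Real.exp (2 * (4 * (1 / 18) * radiusR Λ ^ 4)) * ((X * (Λ / L) + A * Real.exp (-(2 / Λ))) / c) ≤ Λ ^ 4 / 256 := by
  rw [exp_quartic_radius hΛ]
  have hmul : Real.exp ((4 / 9) / Λ) * Real.exp (-(2 / Λ)) = Real.exp (-((14 / 9) / Λ)) := by
    rw [← Real.exp_add]
    congr 1
    ring
  have e : G * Real.exp ((4 / 9) / Λ) * ((X * (Λ / L) + A * Real.exp (-(2 / Λ))) / c) =
      G * Real.exp ((4 / 9) / Λ) * (X * (Λ / L)) / c + G * A / c * (Real.exp ((4 / 9) / Λ) * Real.exp (-(2 / Λ))) := by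
    ring
  rw [e, hmul]
  linarith

/-- The `L`-half of (S8): `G e^{(4/9)/Λ} X(Λ/L)/c ≤ Λ⁴/512` from `512·G·X·e^{(4/9)/lam}/(c·lam³) ≤ L` on the window `lam ≤ Λ`
(`e^{(4/9)/Λ} ≤ e^{(4/9)/lam}`, `lam³ ≤ Λ³`). [cite: Luscher1983, §3] -/
theorem sc_eight_L {G X c lam Λ : ℝ} {L : ℕ} (hG : 0 ≤ G) (hX : 0 ≤ X) (hc : 0 < c) (hlam : 0 < lam) (hΛ : lam ≤ Λ)
    (hL0 : 0 < L) (hL : 512 * G * X * Real.exp ((4 / 9) / lam) / (c * lam ^ 3) ≤ L) :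
    G * Real.exp ((4 / 9) / Λ) * (X * (Λ / L)) / c ≤ Λ ^ 4 / 512 := by
  have hLr : (0 : ℝ) < L := by exact_mod_cast hL0
  have hΛpos : 0 < Λ := hlam.trans_le hΛ
  have hexp : Real.exp ((4 / 9) / Λ) ≤ Real.exp ((4 / 9) / lam) := exp_div_le_exp_div_of_le (by norm_num) hlam hΛ
  have hlam3 : lam ^ 3 ≤ Λ ^ 3 := pow_le_pow_left₀ hlam.le hΛ 3
  have hclam : 0 < c * lam ^ 3 := by positivity
  -- from the threshold: `512 G X e^{(4/9)/lam} ≤ L c lam³`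
  have h1 : 512 * G * X * Real.exp ((4 / 9) / lam) ≤ L * (c * lam ^ 3) := by
    have := (div_le_iff₀ hclam).1 hL
    linarith
  -- target rewritten: `512 G e^{(4/9)/Λ} X Λ ≤ Λ⁴ c L`
  rw [div_le_div_iff₀ hc (by norm_num : (0 : ℝ) < 512)]
  have hGX : 0 ≤ G * X := mul_nonneg hG hX
  have h2 : G * Real.exp ((4 / 9) / Λ) * X ≤ G * Real.exp ((4 / 9) / lam) * X := by
    have := mul_le_mul_of_nonneg_left hexp hG
    exact mul_le_mul_of_nonneg_right this hX
  have h3 : L * (c * lam ^ 3) * Λ ≤ L * (c * Λ ^ 3) * Λ := by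
    have := mul_le_mul_of_nonneg_left hlam3 (mul_nonneg hLr.le hc.le)
    have := mul_le_mul_of_nonneg_right this hΛpos.le
    linarith [this]
  calc G * Real.exp ((4 / 9) / Λ) * (X * (Λ / L)) * 512
      = 512 * (G * Real.exp ((4 / 9) / Λ) * X) * Λ / L := by ring
    _ ≤ 512 * (G * Real.exp ((4 / 9) / lam) * X) * Λ / L := by
        refine div_le_div_of_nonneg_right ?_ hLr.le
        exact mul_le_mul_of_nonneg_right (mul_le_mul_of_nonneg_left h2 (by norm_num)) hΛpos.le
    _ = (512 * G * X * Real.exp ((4 / 9) / lam)) * Λ / L := by ring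
    _ ≤ (L * (c * lam ^ 3)) * Λ / L := by
        refine div_le_div_of_nonneg_right (mul_le_mul_of_nonneg_right h1 hΛpos.le) hLr.le
    _ ≤ (L * (c * Λ ^ 3)) * Λ / L := div_le_div_of_nonneg_right h3 hLr.le
    _ = Λ ^ 4 * c := by field_simp

/-- The `Λ`-half of (S8): `(G A/c)·e^{−(14/9)/Λ} ≤ Λ⁴/512` as soon as `(512·G·A/c)·5!·Λ ≤ (14/9)⁵`. [cite: Luscher1983, §3] -/
theorem sc_eight_Λ {G A c Λ : ℝ} (hG : 0 ≤ G) (hA : 0 ≤ A) (hc : 0 < c) (hΛ : 0 < Λ)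
    (h : 512 * G * A / c * (Nat.factorial 5 : ℝ) * Λ ≤ (14 / 9 : ℝ) ^ 5) :
    G * A / c * Real.exp (-((14 / 9) / Λ)) ≤ Λ ^ 4 / 512 := by
  have hP : 0 ≤ 512 * G * A / c := by positivity
  have h1 := smallΛ_exp_neg_div_mul (P := 512 * G * A / c) (b := 14 / 9) hP (by norm_num) hΛ 4 (by simpa using h)
  have e : 512 * G * A / c * Real.exp (-((14 / 9) / Λ)) = 512 * (G * A / c * Real.exp (-((14 / 9) / Λ))) := by ring
  rw [e] at h1
  linarith

end Summit.QuantumFields.YangMills.Theorems.FemtoTransferGap.PScal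

end
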